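import Mathlib
import Summits.MatrixMultiplication.MatrixMultiplication.Theses.ShapeSubmodularity
import Summits.MatrixMultiplication.MatrixMultiplication.Theorems.ShapeSubmodularityShapeSubmodularStubUnitExchangeBoundary
import Summits.MatrixMultiplication.MatrixMultiplication.Theorems.ShapeSubmodularityShapeSubmodularStubLocalToGlobal
import Summits.MatrixMultiplication.MatrixMultiplication.Theorems.ShapeSubmodularityShapeSubmodularStubExponentThreshold
import Summits.MatrixMultiplication.MatrixMultiplication.Theorems.ShapeSubmodularityShapeSubmodularStubFlatValue
import Summits.MatrixMultiplication.MatrixMultiplication.Theorems.ShapeSubmodularityShapeSubmodularStubCellOfFlatMeet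
import Literature.Computability.AlgebraicComplexity.RectangularExponentAlpha
import Literature.Computability.AlgebraicComplexity.KroneckerRank

/-!
# MatrixMultiplication / ShapeSubmodularity — `ShapeSubmodular` reduces to its fat core

Crux `ShapeSubmodular` (stmt-MatrixMultiplication-15622, route `ShapeSubmodularity`): the rectangular exponent
`(a,b,c) ↦ ω(a,b,c)` is submodular on the integer format lattice `ℕ³`, in RANK FORM (admissible exponents `β` of
`R(a,b,c) := n ↦ tensorRank (matMulTensor ℂ (n^a) (n^b) (n^c))`, with an `ε` of room).  This file assembles the
five landed stubs of line `registered` (Cruxes/ShapeSubmodular/Lines/birth.lean) into sorry-free THEOREMS: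

* `submod_of_threshold_family` — the composition as an order-theoretic lemma: a rotation-invariant family of
  upper rays indexed by `ℕ³` that exchanges on the unit cells of ONE coordinate plane exchanges on every pair of
  formats (thresholds + Topkis `stub_localToGlobal` + `S₃`-symmetry);
* `tensorRank_pow_sort` — `R(a,b,c) = R(x,z,y)` with `x ≥ y ≥ z` the sorted exponents (Bläser 2013, Lemma 5.5);
* `flatValue_of_le_alpha` — an α-FLAT format, `min(a,b,c) ≤ α · median(a,b,c)` with
  `α = dualExponentAlpha ℂ` (`ω(1,p,1) = 2 ↔ p ≤ α`), has the flattening exponent: for every `ε > 0`,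
  `R(a,b,c) = O(n^{max(a+b,b+c,a+c)+ε})` (`stub_flatValue` after sorting);
* `unitExchange_of_flatMeet` — the unit exchange law `ω(a+1,b+1,c) + ω(a,b,c) ≤ ω(a+1,b,c) + ω(a,b+1,c)`
  (rank form) holds at every interior cell whose MEET `(a,b,c)` is α-flat (`stub_cellOfFlatMeet`);
* `unitExchange_of_coreExchange` — hence the law on ALL cells follows from the law on the FAT CORE
  `α · median < min` (boundary cells: `stub_unitExchangeBoundary`);
* `ShapeSubmodular_of_coreExchange`, `coreExchange_of_ShapeSubmodular`, `ShapeSubmodular_iff_coreExchange` —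
  **the crux is equivalent to the unit exchange law on the fat core**, a cone around the diagonal of `ℕ³`
  (every cube cell `(k,k,k)` is in it; if `α = 1`, i.e. `ω = 2`, it is EMPTY and the crux follows — the
  route's `SubmodOfOmegaTwo` in one line, see `ShapeSubmodular_of_alpha_eq_one`).

What remains open is exactly the registered stub `stub_coreExchange` of the skeleton (first cell `(1,1,1)`:
`ω(2,2,1) + ω ≤ 2·ω(1,1,2)`); no single core cell is decided by the pointwise bounds in print (flattening below,
laser-method tables above), see the evidence `core-price-c2.md` on the item.
-/

set_option linter.dupNamespace false
-- (single-conjunct summit: the namespace repeats `MatrixMultiplication`)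

namespace Summit.MatrixMultiplication.MatrixMultiplication.Theorems.ShapeSubmodular

open Summit.MatrixMultiplication.MatrixMultiplication.Theses.ShapeSubmodularity
open Literature.Computability.AlgebraicComplexity
open Filter Asymptotics

/-! ## The composition, as an order-theoretic lemma -/

/-- **Threshold families are submodular once they exchange on unit cells** (the composition of the line, as an
order-theoretic lemma about an arbitrary family `adm : ℕ³ → Set ℝ` of "admissible exponents"): if every
`adm (a,b,c)` is an upper ray with a threshold (`hT`), the family is invariant under the cyclic rotation of the
format (`hrot`), real functions on `ℕ³` with decreasing differences in the three coordinate planes are lattice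
submodular (`hL`, Topkis — the landed `stub_localToGlobal`), and the family satisfies the unit exchange law in
the coordinate pair (1,2) (`hU`), then it satisfies the exchange law for EVERY pair of formats (join/meet), with
an `ε` of room.  Proof: thresholds `m`; local law for `m` at slack `δ/4`; `m` is rotation invariant; the two
other planes by rotation; Topkis; back to the sets at slack `ε/2`. [folklore] -/
theorem submod_of_threshold_family (adm : ℕ → ℕ → ℕ → Set ℝ)
    (hrot : ∀ a b c : ℕ, ∀ β : ℝ, β ∈ adm a b c ↔ β ∈ adm b c a)
    (hT : ∀ a b c : ℕ, ∃ m : ℝ, (∀ β : ℝ, m < β → β ∈ adm a b c) ∧ (∀ β : ℝ, β ∈ adm a b c → m ≤ β))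
    (hL : ∀ f : ℕ → ℕ → ℕ → ℝ,
      (∀ a b c : ℕ, f (a + 1) (b + 1) c + f a b c ≤ f (a + 1) b c + f a (b + 1) c) →
      (∀ a b c : ℕ, f a (b + 1) (c + 1) + f a b c ≤ f a (b + 1) c + f a b (c + 1)) →
      (∀ a b c : ℕ, f (a + 1) b (c + 1) + f a b c ≤ f (a + 1) b c + f a b (c + 1)) →
      ∀ a b c a' b' c' : ℕ,
        f (max a a') (max b b') (max c c') + f (min a a') (min b b') (min c c') ≤
          f a b c + f a' b' c')
    (hU : ∀ a b c : ℕ, ∀ β β' : ℝ, β ∈ adm (a + 1) b c → β' ∈ adm a (b + 1) c →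
      ∀ ε : ℝ, 0 < ε → ∃ γ γ' : ℝ, γ + γ' ≤ β + β' + ε ∧ γ ∈ adm (a + 1) (b + 1) c ∧ γ' ∈ adm a b c) :
    ∀ a b c a' b' c' : ℕ, ∀ β β' : ℝ, β ∈ adm a b c → β' ∈ adm a' b' c' →
      ∀ ε : ℝ, 0 < ε → ∃ γ γ' : ℝ, γ + γ' ≤ β + β' + ε ∧
        γ ∈ adm (max a a') (max b b') (max c c') ∧ γ' ∈ adm (min a a') (min b b') (min c c') := by
  -- the threshold (exponent) function `m (a,b,c) = ω(a,b,c)` and its two defining properties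
  choose m hm_adm hm_le using hT
  -- (1) the local exchange law for `m` in the pair (1,2), from the rank-form stub at slack `δ/4`
  have loc12 : ∀ a b c : ℕ, m (a + 1) (b + 1) c + m a b c ≤ m (a + 1) b c + m a (b + 1) c := by
    intro a b c
    refine le_of_forall_pos_lt_add fun δ hδ => ?_
    obtain ⟨γ, γ', hsum, hγ, hγ'⟩ := hU a b c (m (a + 1) b c + δ / 4) (m a (b + 1) c + δ / 4)
      (hm_adm _ _ _ _ (by linarith)) (hm_adm _ _ _ _ (by linarith)) (δ / 4) (by positivity)
    have h₁ := hm_le _ _ _ _ hγ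
    have h₂ := hm_le _ _ _ _ hγ'
    linarith
  -- (2) cyclic symmetry of `m`: both sides are the threshold of the same admissible set
  have mrot : ∀ a b c : ℕ, m a b c = m b c a := by
    intro a b c
    apply le_antisymm
    · refine le_of_forall_pos_lt_add fun δ hδ => ?_
      have h : (m b c a + δ / 2) ∈ adm a b c :=
        (hrot a b c _).2 (hm_adm b c a (m b c a + δ / 2) (by linarith))
      have := hm_le _ _ _ _ h
      linarith
    · refine le_of_forall_pos_lt_add fun δ hδ => ?_
      have h : (m a b c + δ / 2) ∈ adm b c a :=
        (hrot a b c _).1 (hm_adm a b c (m a b c + δ / 2) (by linarith))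
      have := hm_le _ _ _ _ h
      linarith
  -- (3) the local laws in the pairs (2,3) and (1,3), by rotating (1,2)
  have loc23 : ∀ a b c : ℕ, m a (b + 1) (c + 1) + m a b c ≤ m a (b + 1) c + m a b (c + 1) := by
    intro a b c
    linarith [loc12 b c a, mrot a (b + 1) (c + 1), mrot a b c, mrot a (b + 1) c, mrot a b (c + 1)]
  have loc13 : ∀ a b c : ℕ, m (a + 1) b (c + 1) + m a b c ≤ m (a + 1) b c + m a b (c + 1) := by
    intro a b c
    linarith [loc12 c a b, mrot (c + 1) (a + 1) b, mrot c a b, mrot (c + 1) a b, mrot c (a + 1) b]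
  -- (4) Topkis: `m` is submodular on the format lattice
  have sub := hL m loc12 loc23 loc13
  -- (5) back to rank form at slack `ε/2` on each of join and meet
  intro a b c a' b' c' β β' hβ hβ' ε hε
  have h₁ : m a b c ≤ β := hm_le _ _ _ _ hβ
  have h₂ : m a' b' c' ≤ β' := hm_le _ _ _ _ hβ'
  refine ⟨m (max a a') (max b b') (max c c') + ε / 2, m (min a a') (min b b') (min c c') + ε / 2, ?_,
    hm_adm _ _ _ _ (by linarith), hm_adm _ _ _ _ (by linarith)⟩
  have h₃ := sub a b c a' b' c'
  linarith

/-! ## Sorting a format and the flat value -/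

/-- SORTING A NATURAL FORMAT: `R⟨n^a, n^b, n^c⟩ = R⟨n^x, n^z, n^y⟩` with `x ≥ y ≥ z` the sorted
exponents (`x = max`, `y = median`, `z = min`, `x + y = max(a+b, b+c, a+c)`), by the `S₃`-symmetry of the
rank of matrix multiplication (Bläser 2013, Lemma 5.5: `tensorRank_matMulTensor_rotate`,
`tensorRank_matMulTensor_transpose`). [cite: Blaser2013, Lemma 5.5] -/
theorem tensorRank_pow_sort (a b c : ℕ) :
    ∃ x y z : ℕ, z ≤ y ∧ y ≤ x ∧ x = max a (max b c) ∧ z = min a (min b c) ∧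
      y = max (min a b) (min (max a b) c) ∧ x + y = max (a + b) (max (b + c) (a + c)) ∧
      ∀ n : ℕ, tensorRank (matMulTensor ℂ (n ^ a) (n ^ b) (n ^ c)) =
        tensorRank (matMulTensor ℂ (n ^ x) (n ^ z) (n ^ y)) := by
  rcases le_total b a with hba | hab
  · rcases le_total c b with hcb | hbc
    · -- `c ≤ b ≤ a`: `(x,y,z) = (a,b,c)`, target `⟨a,c,b⟩`
      refine ⟨a, b, c, hcb, hba, ?_, ?_, ?_, ?_, fun n => ?_⟩
      · omega
      · omega
      · omega
      · omega
      · rw [tensorRank_matMulTensor_rotate ℂ (n ^ a) (n ^ b) (n ^ c),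
          tensorRank_matMulTensor_transpose ℂ (n ^ b) (n ^ c) (n ^ a)]
    · rcases le_total c a with hca | hac
      · -- `b ≤ c ≤ a`: `(x,y,z) = (a,c,b)`, target `⟨a,b,c⟩`
        refine ⟨a, c, b, hbc, hca, ?_, ?_, ?_, ?_, fun n => rfl⟩
        · omega
        · omega
        · omega
        · omega
      · -- `b ≤ a ≤ c`: `(x,y,z) = (c,a,b)`, target `⟨c,b,a⟩`
        refine ⟨c, a, b, hba, hac, ?_, ?_, ?_, ?_, fun n => ?_⟩
        · omega
        · omega
        · omega
        · omega
        · rw [tensorRank_matMulTensor_transpose ℂ (n ^ a) (n ^ b) (n ^ c)]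
  · rcases le_total c a with hca | hac
    · -- `c ≤ a ≤ b`: `(x,y,z) = (b,a,c)`, target `⟨b,c,a⟩`
      refine ⟨b, a, c, hca, hab, ?_, ?_, ?_, ?_, fun n => ?_⟩
      · omega
      · omega
      · omega
      · omega
      · rw [tensorRank_matMulTensor_rotate ℂ (n ^ a) (n ^ b) (n ^ c)]
    · rcases le_total c b with hcb | hbc
      · -- `a ≤ c ≤ b`: `(x,y,z) = (b,c,a)`, target `⟨b,a,c⟩`
        refine ⟨b, c, a, hac, hcb, ?_, ?_, ?_, ?_, fun n => ?_⟩
        · omega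
        · omega
        · omega
        · omega
        · rw [tensorRank_matMulTensor_transpose ℂ (n ^ a) (n ^ b) (n ^ c),
            tensorRank_matMulTensor_rotate ℂ (n ^ c) (n ^ b) (n ^ a)]
      · -- `a ≤ b ≤ c`: `(x,y,z) = (c,b,a)`, target `⟨c,a,b⟩`
        refine ⟨c, b, a, hab, hbc, ?_, ?_, ?_, ?_, fun n => ?_⟩
        · omega
        · omega
        · omega
        · omega
        · rw [tensorRank_matMulTensor_rotate ℂ (n ^ a) (n ^ b) (n ^ c),
            tensorRank_matMulTensor_rotate ℂ (n ^ b) (n ^ c) (n ^ a)]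

/-- **Flat value**: if `min(a,b,c) ≤ α · median(a,b,c)` (`α = dualExponentAlpha ℂ`, `a, b ≥ 1`), then for every
`ε > 0`, `R⟨n^a, n^b, n^c⟩ = O(n^{L+ε})` with `L = max(a+b, b+c, a+c)` the flattening exponent: sort the format
(`tensorRank_pow_sort`) and apply `stub_flatValue` (`ω(1, z/y, 1) = 2` for `z ≤ α y`, homogeneity, blocking).
With the flattening LOWER bound this says `ω(a,b,c) = L` on the flat region. [folklore] -/
theorem flatValue_of_le_alpha (a b c : ℕ) (ha : 1 ≤ a) (hb : 1 ≤ b)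
    (hflat : ((min a (min b c) : ℕ) : ℝ) ≤
      dualExponentAlpha ℂ * ((max (min a b) (min (max a b) c) : ℕ) : ℝ)) :
    ∀ ε : ℝ, 0 < ε →
      (fun n : ℕ => (tensorRank (matMulTensor ℂ (n ^ a) (n ^ b) (n ^ c)) : ℝ)) =O[atTop]
        (fun n : ℕ => (n : ℝ) ^ (((max (a + b) (max (b + c) (a + c)) : ℕ) : ℝ) + ε)) := by
  intro ε hε
  obtain ⟨x, y, z, _hzy, hyx, hx, hz, hy, hxy, hR⟩ := tensorRank_pow_sort a b c
  have hy1 : 1 ≤ y := by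
    rw [hy]
    exact le_max_of_le_left (le_min ha hb)
  have hzα : (z : ℝ) ≤ dualExponentAlpha ℂ * (y : ℝ) := by
    rw [hz, hy]
    exact hflat
  have h := stub_flatValue x y z hy1 hyx hzα ε hε
  have hfun : (fun n : ℕ => (tensorRank (matMulTensor ℂ (n ^ a) (n ^ b) (n ^ c)) : ℝ)) =
      fun n : ℕ => (tensorRank (matMulTensor ℂ (n ^ x) (n ^ z) (n ^ y)) : ℝ) := by
    funext n
    rw [hR n]
  have hexp : ((max (a + b) (max (b + c) (a + c)) : ℕ) : ℝ) = (x : ℝ) + (y : ℝ) := by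
    rw [← hxy]
    push_cast
    ring
  rw [hfun, hexp]
  exact h

/-! ## The unit exchange law: flat cells, and all cells from the core -/

/-- **Unit exchange at a flat meet**: for `a, b ≥ 1` (any `c`) with `min(a,b,c) ≤ α · median(a,b,c)`, the unit
exchange law in the coordinate pair (1,2) holds at the cell with meet `(a,b,c)`, in rank form
(`flatValue_of_le_alpha` + `stub_cellOfFlatMeet`). [folklore] -/
theorem unitExchange_of_flatMeet (a b c : ℕ) (ha : 1 ≤ a) (hb : 1 ≤ b)
    (hflat : ((min a (min b c) : ℕ) : ℝ) ≤
      dualExponentAlpha ℂ * ((max (min a b) (min (max a b) c) : ℕ) : ℝ)) :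
      ∀ β β' : ℝ,
      (fun n : ℕ => (Literature.Computability.AlgebraicComplexity.tensorRank
        (Literature.Computability.AlgebraicComplexity.matMulTensor ℂ (n ^ (a + 1)) (n ^ b) (n ^ c)) : ℝ))
          =O[Filter.atTop] (fun n : ℕ => (n : ℝ) ^ β) →
      (fun n : ℕ => (Literature.Computability.AlgebraicComplexity.tensorRank
        (Literature.Computability.AlgebraicComplexity.matMulTensor ℂ (n ^ a) (n ^ (b + 1)) (n ^ c)) : ℝ))
          =O[Filter.atTop] (fun n : ℕ => (n : ℝ) ^ β') →
      ∀ ε : ℝ, 0 < ε → ∃ γ γ' : ℝ, γ + γ' ≤ β + β' + ε ∧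
        (fun n : ℕ => (Literature.Computability.AlgebraicComplexity.tensorRank
          (Literature.Computability.AlgebraicComplexity.matMulTensor ℂ
            (n ^ (a + 1)) (n ^ (b + 1)) (n ^ c)) : ℝ))
            =O[Filter.atTop] (fun n : ℕ => (n : ℝ) ^ γ) ∧
        (fun n : ℕ => (Literature.Computability.AlgebraicComplexity.tensorRank
          (Literature.Computability.AlgebraicComplexity.matMulTensor ℂ (n ^ a) (n ^ b) (n ^ c)) : ℝ))
            =O[Filter.atTop] (fun n : ℕ => (n : ℝ) ^ γ') :=
  stub_cellOfFlatMeet a b c (flatValue_of_le_alpha a b c ha hb hflat)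

/-- **All cells from the core**: if the unit exchange law holds on the FAT CORE (`a, b, c ≥ 1`,
`α · median(a,b,c) < min(a,b,c)`), it holds at every cell of `ℕ³`: boundary cells by
`stub_unitExchangeBoundary`, flat interior cells by `unitExchange_of_flatMeet`. [folklore] -/
theorem unitExchange_of_coreExchange
    (hcore : ∀ a b c : ℕ, 1 ≤ a → 1 ≤ b → 1 ≤ c →
      Literature.Computability.AlgebraicComplexity.dualExponentAlpha ℂ *
          ((max (min a b) (min (max a b) c) : ℕ) : ℝ) < ((min a (min b c) : ℕ) : ℝ) →
      ∀ β β' : ℝ,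
      (fun n : ℕ => (Literature.Computability.AlgebraicComplexity.tensorRank
        (Literature.Computability.AlgebraicComplexity.matMulTensor ℂ (n ^ (a + 1)) (n ^ b) (n ^ c)) : ℝ))
          =O[Filter.atTop] (fun n : ℕ => (n : ℝ) ^ β) →
      (fun n : ℕ => (Literature.Computability.AlgebraicComplexity.tensorRank
        (Literature.Computability.AlgebraicComplexity.matMulTensor ℂ (n ^ a) (n ^ (b + 1)) (n ^ c)) : ℝ))
          =O[Filter.atTop] (fun n : ℕ => (n : ℝ) ^ β') →
      ∀ ε : ℝ, 0 < ε → ∃ γ γ' : ℝ, γ + γ' ≤ β + β' + ε ∧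
        (fun n : ℕ => (Literature.Computability.AlgebraicComplexity.tensorRank
          (Literature.Computability.AlgebraicComplexity.matMulTensor ℂ
            (n ^ (a + 1)) (n ^ (b + 1)) (n ^ c)) : ℝ))
            =O[Filter.atTop] (fun n : ℕ => (n : ℝ) ^ γ) ∧
        (fun n : ℕ => (Literature.Computability.AlgebraicComplexity.tensorRank
          (Literature.Computability.AlgebraicComplexity.matMulTensor ℂ (n ^ a) (n ^ b) (n ^ c)) : ℝ))
            =O[Filter.atTop] (fun n : ℕ => (n : ℝ) ^ γ')) :
    ∀ a b c : ℕ,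
      ∀ β β' : ℝ,
      (fun n : ℕ => (Literature.Computability.AlgebraicComplexity.tensorRank
        (Literature.Computability.AlgebraicComplexity.matMulTensor ℂ (n ^ (a + 1)) (n ^ b) (n ^ c)) : ℝ))
          =O[Filter.atTop] (fun n : ℕ => (n : ℝ) ^ β) →
      (fun n : ℕ => (Literature.Computability.AlgebraicComplexity.tensorRank
        (Literature.Computability.AlgebraicComplexity.matMulTensor ℂ (n ^ a) (n ^ (b + 1)) (n ^ c)) : ℝ))
          =O[Filter.atTop] (fun n : ℕ => (n : ℝ) ^ β') →
      ∀ ε : ℝ, 0 < ε → ∃ γ γ' : ℝ, γ + γ' ≤ β + β' + ε ∧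
        (fun n : ℕ => (Literature.Computability.AlgebraicComplexity.tensorRank
          (Literature.Computability.AlgebraicComplexity.matMulTensor ℂ
            (n ^ (a + 1)) (n ^ (b + 1)) (n ^ c)) : ℝ))
            =O[Filter.atTop] (fun n : ℕ => (n : ℝ) ^ γ) ∧
        (fun n : ℕ => (Literature.Computability.AlgebraicComplexity.tensorRank
          (Literature.Computability.AlgebraicComplexity.matMulTensor ℂ (n ^ a) (n ^ b) (n ^ c)) : ℝ))
            =O[Filter.atTop] (fun n : ℕ => (n : ℝ) ^ γ') := by
  intro a b c β β' h₁ h₂ ε hε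
  rcases Nat.eq_zero_or_pos a with ha | ha
  · exact stub_unitExchangeBoundary a b c (Or.inl ha) β β' h₁ h₂ ε hε
  rcases Nat.eq_zero_or_pos b with hb | hb
  · exact stub_unitExchangeBoundary a b c (Or.inr (Or.inl hb)) β β' h₁ h₂ ε hε
  rcases Nat.eq_zero_or_pos c with hc | hc
  · exact stub_unitExchangeBoundary a b c (Or.inr (Or.inr hc)) β β' h₁ h₂ ε hε
  by_cases hc' : dualExponentAlpha ℂ * ((max (min a b) (min (max a b) c) : ℕ) : ℝ) <
      ((min a (min b c) : ℕ) : ℝ)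
  · exact hcore a b c ha hb hc hc' β β' h₁ h₂ ε hε
  · rw [not_lt] at hc'
    exact unitExchange_of_flatMeet a b c ha hb hc' β β' h₁ h₂ ε hε

/-! ## The crux is equivalent to the core exchange law -/

/-- **`ShapeSubmodular` from the core exchange law**: thresholds (`stub_exponentThreshold`), Topkis
(`stub_localToGlobal`), cyclic symmetry of the rank (`tensorRank_matMulTensor_rotate`) and the unit exchange law on
all cells (`unitExchange_of_coreExchange`), composed by `submod_of_threshold_family`. [folklore] -/
theorem ShapeSubmodular_of_coreExchange
    (hcore : ∀ a b c : ℕ, 1 ≤ a → 1 ≤ b → 1 ≤ c →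
      Literature.Computability.AlgebraicComplexity.dualExponentAlpha ℂ *
          ((max (min a b) (min (max a b) c) : ℕ) : ℝ) < ((min a (min b c) : ℕ) : ℝ) →
      ∀ β β' : ℝ,
      (fun n : ℕ => (Literature.Computability.AlgebraicComplexity.tensorRank
        (Literature.Computability.AlgebraicComplexity.matMulTensor ℂ (n ^ (a + 1)) (n ^ b) (n ^ c)) : ℝ))
          =O[Filter.atTop] (fun n : ℕ => (n : ℝ) ^ β) →
      (fun n : ℕ => (Literature.Computability.AlgebraicComplexity.tensorRank
        (Literature.Computability.AlgebraicComplexity.matMulTensor ℂ (n ^ a) (n ^ (b + 1)) (n ^ c)) : ℝ))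
          =O[Filter.atTop] (fun n : ℕ => (n : ℝ) ^ β') →
      ∀ ε : ℝ, 0 < ε → ∃ γ γ' : ℝ, γ + γ' ≤ β + β' + ε ∧
        (fun n : ℕ => (Literature.Computability.AlgebraicComplexity.tensorRank
          (Literature.Computability.AlgebraicComplexity.matMulTensor ℂ
            (n ^ (a + 1)) (n ^ (b + 1)) (n ^ c)) : ℝ))
            =O[Filter.atTop] (fun n : ℕ => (n : ℝ) ^ γ) ∧
        (fun n : ℕ => (Literature.Computability.AlgebraicComplexity.tensorRank
          (Literature.Computability.AlgebraicComplexity.matMulTensor ℂ (n ^ a) (n ^ b) (n ^ c)) : ℝ))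
            =O[Filter.atTop] (fun n : ℕ => (n : ℝ) ^ γ')) :
    ShapeSubmodular := by
  have hrot : ∀ a b c : ℕ, ∀ β : ℝ,
      β ∈ {β : ℝ | (fun n : ℕ => (tensorRank (matMulTensor ℂ (n ^ a) (n ^ b) (n ^ c)) : ℝ)) =O[atTop]
        (fun n : ℕ => (n : ℝ) ^ β)} ↔
      β ∈ {β : ℝ | (fun n : ℕ => (tensorRank (matMulTensor ℂ (n ^ b) (n ^ c) (n ^ a)) : ℝ)) =O[atTop]
        (fun n : ℕ => (n : ℝ) ^ β)} := by
    intro a b c β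
    simp only [Set.mem_setOf_eq]
    have h : (fun n : ℕ => (tensorRank (matMulTensor ℂ (n ^ a) (n ^ b) (n ^ c)) : ℝ)) =
        fun n : ℕ => (tensorRank (matMulTensor ℂ (n ^ b) (n ^ c) (n ^ a)) : ℝ) := by
      funext n
      rw [tensorRank_matMulTensor_rotate ℂ (n ^ a) (n ^ b) (n ^ c)]
    rw [h]
  exact submod_of_threshold_family
    (fun a b c => {β : ℝ | (fun n : ℕ => (tensorRank (matMulTensor ℂ (n ^ a) (n ^ b) (n ^ c)) : ℝ))
      =O[atTop] (fun n : ℕ => (n : ℝ) ^ β)})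
    hrot stub_exponentThreshold stub_localToGlobal (unitExchange_of_coreExchange hcore)

/-- **The core exchange law from `ShapeSubmodular`**: the crux at the adjacent pair `p = (a+1,b,c)`,
`q = (a,b+1,c)` (join `(a+1,b+1,c)`, meet `(a,b,c)`) is the unit exchange law at the cell `(a,b,c)` — on every
cell, so in particular on the core. [folklore] -/
theorem coreExchange_of_ShapeSubmodular (hS : ShapeSubmodular) :
    ∀ a b c : ℕ, 1 ≤ a → 1 ≤ b → 1 ≤ c →
      Literature.Computability.AlgebraicComplexity.dualExponentAlpha ℂ *
          ((max (min a b) (min (max a b) c) : ℕ) : ℝ) < ((min a (min b c) : ℕ) : ℝ) →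
      ∀ β β' : ℝ,
      (fun n : ℕ => (Literature.Computability.AlgebraicComplexity.tensorRank
        (Literature.Computability.AlgebraicComplexity.matMulTensor ℂ (n ^ (a + 1)) (n ^ b) (n ^ c)) : ℝ))
          =O[Filter.atTop] (fun n : ℕ => (n : ℝ) ^ β) →
      (fun n : ℕ => (Literature.Computability.AlgebraicComplexity.tensorRank
        (Literature.Computability.AlgebraicComplexity.matMulTensor ℂ (n ^ a) (n ^ (b + 1)) (n ^ c)) : ℝ))
          =O[Filter.atTop] (fun n : ℕ => (n : ℝ) ^ β') →
      ∀ ε : ℝ, 0 < ε → ∃ γ γ' : ℝ, γ + γ' ≤ β + β' + ε ∧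
        (fun n : ℕ => (Literature.Computability.AlgebraicComplexity.tensorRank
          (Literature.Computability.AlgebraicComplexity.matMulTensor ℂ
            (n ^ (a + 1)) (n ^ (b + 1)) (n ^ c)) : ℝ))
            =O[Filter.atTop] (fun n : ℕ => (n : ℝ) ^ γ) ∧
        (fun n : ℕ => (Literature.Computability.AlgebraicComplexity.tensorRank
          (Literature.Computability.AlgebraicComplexity.matMulTensor ℂ (n ^ a) (n ^ b) (n ^ c)) : ℝ))
            =O[Filter.atTop] (fun n : ℕ => (n : ℝ) ^ γ') := by
  intro a b c _ha _hb _hc _hcore β β' h₁ h₂ ε hε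
  obtain ⟨γ, γ', hsum, hjoin, hmeet⟩ := hS (a + 1) b c a (b + 1) c β β' h₁ h₂ ε hε
  rw [max_eq_left (Nat.le_succ a), max_eq_right (Nat.le_succ b), max_self] at hjoin
  rw [min_eq_right (Nat.le_succ a), min_eq_left (Nat.le_succ b), min_self] at hmeet
  exact ⟨γ, γ', hsum, hjoin, hmeet⟩

/-- **The crux `ShapeSubmodular` is equivalent to the unit exchange law on the fat core**
`{(a,b,c) ∈ ℕ³ : a,b,c ≥ 1, α · median(a,b,c) < min(a,b,c)}` (`α = dualExponentAlpha ℂ`): SUBMOD can fail, if at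
all, only through near-cubic formats. [folklore] -/
theorem ShapeSubmodular_iff_coreExchange :
    Summit.MatrixMultiplication.MatrixMultiplication.Theses.ShapeSubmodularity.ShapeSubmodular ↔
    (∀ a b c : ℕ, 1 ≤ a → 1 ≤ b → 1 ≤ c →
      Literature.Computability.AlgebraicComplexity.dualExponentAlpha ℂ *
          ((max (min a b) (min (max a b) c) : ℕ) : ℝ) < ((min a (min b c) : ℕ) : ℝ) →
      ∀ β β' : ℝ,
      (fun n : ℕ => (Literature.Computability.AlgebraicComplexity.tensorRank
        (Literature.Computability.AlgebraicComplexity.matMulTensor ℂ (n ^ (a + 1)) (n ^ b) (n ^ c)) : ℝ))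
          =O[Filter.atTop] (fun n : ℕ => (n : ℝ) ^ β) →
      (fun n : ℕ => (Literature.Computability.AlgebraicComplexity.tensorRank
        (Literature.Computability.AlgebraicComplexity.matMulTensor ℂ (n ^ a) (n ^ (b + 1)) (n ^ c)) : ℝ))
          =O[Filter.atTop] (fun n : ℕ => (n : ℝ) ^ β') →
      ∀ ε : ℝ, 0 < ε → ∃ γ γ' : ℝ, γ + γ' ≤ β + β' + ε ∧
        (fun n : ℕ => (Literature.Computability.AlgebraicComplexity.tensorRank
          (Literature.Computability.AlgebraicComplexity.matMulTensor ℂ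
            (n ^ (a + 1)) (n ^ (b + 1)) (n ^ c)) : ℝ))
            =O[Filter.atTop] (fun n : ℕ => (n : ℝ) ^ γ) ∧
        (fun n : ℕ => (Literature.Computability.AlgebraicComplexity.tensorRank
          (Literature.Computability.AlgebraicComplexity.matMulTensor ℂ (n ^ a) (n ^ b) (n ^ c)) : ℝ))
            =O[Filter.atTop] (fun n : ℕ => (n : ℝ) ^ γ')) :=
  ⟨coreExchange_of_ShapeSubmodular, ShapeSubmodular_of_coreExchange⟩

/-- **If `α = 1` the core is empty and `ShapeSubmodular` holds** (`α = 1 ↔ ω = 2`,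
`dualExponentAlpha_eq_one_iff`; this is the route's necessity item `SubmodOfOmegaTwo` up to that rewriting):
`median ≥ min` makes `1 · median < min` impossible. [folklore] -/
theorem ShapeSubmodular_of_alpha_eq_one (hα : dualExponentAlpha ℂ = 1) : ShapeSubmodular := by
  refine ShapeSubmodular_of_coreExchange fun a b c _ha _hb _hc hcore => ?_
  exfalso
  rw [hα, one_mul] at hcore
  have h : min a (min b c) ≤ max (min a b) (min (max a b) c) := by omega
  have h' : ((min a (min b c) : ℕ) : ℝ) ≤ ((max (min a b) (min (max a b) c) : ℕ) : ℝ) := by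
    exact_mod_cast h
  exact absurd hcore (not_lt.2 h')

/-- **`ω = 2` implies `ShapeSubmodular`** (the route item `SubmodOfOmegaTwo` reads
`MatrixMultiplication → ShapeSubmodular`; here from `omega ℂ = 2` via `α = 1`). [folklore] -/
theorem ShapeSubmodular_of_omega_eq_two (hω : omega ℂ = 2) : ShapeSubmodular :=
  ShapeSubmodular_of_alpha_eq_one ((dualExponentAlpha_eq_one_iff ℂ).2 hω)

end Summit.MatrixMultiplication.MatrixMultiplication.Theorems.ShapeSubmodular
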